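import Literature.MathematicalPhysics.StatisticalMechanics.HcpFccLatticeSumsPrep
import Literature.MathematicalPhysics.StatisticalMechanics.HcpFccLatticeSumsNumJ3a
import Literature.MathematicalPhysics.StatisticalMechanics.HcpFccLatticeSumsNumJ3b
import Literature.MathematicalPhysics.StatisticalMechanics.HcpFccLatticeSumsNumL3
import Literature.MathematicalPhysics.StatisticalMechanics.HcpFccLatticeSumsNum6

/-!
# Certified hcp/fcc lattice sums: the certificate

Assembly of the truncations (`…Prep.lean`) with the certified enclosures (`…NumJ3a/b`, `…NumL3`,
`…Num6`):

* `hcp_sub_fcc_three_bounds`: `0.00097526 ≤ L₆ʰᶜᵖ − L₆ᶠᶜᶜ ≤ 0.00097722`,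
  `hcp_sub_fcc_six_bounds`: `0.000413572 ≤ L₁₂ʰᶜᵖ − L₁₂ᶠᶜᶜ ≤ 0.000413573` (`c² = 2/3`);
* `hcpInvPowSum_three_bounds`: `14.4542 ≤ L₆ʰᶜᵖ ≤ 14.4593`, `hcpInvPowSum_six_bounds`:
  `12.1322937 ≤ L₁₂ʰᶜᵖ ≤ 12.1322946`, and the fcc values by difference (printed, non-certified values:
  `L₆ = 14.45490 / 14.45392`, `L₁₂ = 12.13229 / 12.13188`, Schwerdtfeger–Burrows–Smits 2021 p. 8,
  Stillinger 2001);
* **`hcp_fcc_shapeGap`**: `0.0017363 ≤ (L₆ʰ)²/L₁₂ʰ − (L₆ᶠ)²/L₁₂ᶠ ≤ 0.0017423` — monomial-wise interval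
  arithmetic on `x_h² y_f − x_f² y_h = 2 x_h y_h D₃ − x_h² D₆ − y_h D₃²`, which needs the absolute sums
  only crudely and the DIFFERENCES `D₃, D₆` sharply;
* the scaling lemmas `lj_scale_energy_ge/attained`: `min_{a} ½(a⁻¹²y/12 − a⁻⁶x/6) = −x²/(24y)`.

## References
* F. H. Stillinger, *Lattice sums and their phase diagram implications for the classical
  Lennard-Jones model*, J. Chem. Phys. 115 (2001) 5208–5212, §II.
* P. Schwerdtfeger, A. Burrows, O. R. Smits, *The Lennard-Jones potential revisited*, J. Phys.
  Chem. A 125 (2021) 3037–3057 (arXiv:2012.05413, p. 8: `L₆, L₁₂` of fcc and hcp).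
-/

noncomputable section

namespace Literature.MathematicalPhysics.StatisticalMechanics.StackingSums

open Finset

/-- **`D₃ = L₆ʰᶜᵖ − L₆ᶠᶜᶜ` at `c² = 2/3`**: `0.00097526 ≤ D₃ ≤ 0.00097722`. [folklore] -/
theorem hcp_sub_fcc_three_bounds :
    (0.00097526 : ℝ) ≤ hcpInvPowSum 3 (Real.sqrt (2 / 3)) - fccInvPowSum 3 (Real.sqrt (2 / 3)) ∧
      hcpInvPowSum 3 (Real.sqrt (2 / 3)) - fccInvPowSum 3 (Real.sqrt (2 / 3)) ≤ 0.00097722 := by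
  obtain ⟨h1, h2⟩ := abs_le.1 hcp_sub_fcc_three_trunc
  generalize Real.sqrt (2 / 3) = c at h1 h2 ⊢
  simp only [sum_range_succ, sum_range_zero] at h1 h2
  norm_num at h1 h2
  constructor <;> linarith [registryCoupling_three_at_2.1, registryCoupling_three_at_2.2, registryCoupling_three_at_3.1, registryCoupling_three_at_3.2, registryCoupling_three_at_4.1, registryCoupling_three_at_4.2, registryCoupling_three_at_8.1, registryCoupling_three_at_8.2, registryCoupling_three_at_9.1, registryCoupling_three_at_9.2, registryCoupling_three_at_10.1, registryCoupling_three_at_10.2, registryCoupling_three_at_14.1, registryCoupling_three_at_14.2, registryCoupling_three_at_15.1, registryCoupling_three_at_15.2, registryCoupling_three_at_16.1, registryCoupling_three_at_16.2, registryCoupling_three_at_20.1, registryCoupling_three_at_20.2, registryCoupling_three_at_21.1, registryCoupling_three_at_21.2, registryCoupling_three_at_22.1, registryCoupling_three_at_22.2, registryCoupling_three_at_26.1, registryCoupling_three_at_26.2, registryCoupling_three_at_27.1, registryCoupling_three_at_27.2, registryCoupling_three_at_28.1, registryCoupling_three_at_28.2, registryCoupling_three_at_32.1, registryCoupling_three_at_32.2,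 registryCoupling_three_at_33.1, registryCoupling_three_at_33.2, registryCoupling_three_at_34.1, registryCoupling_three_at_34.2, registryCoupling_three_at_38.1, registryCoupling_three_at_38.2, registryCoupling_three_at_39.1, registryCoupling_three_at_39.2, registryCoupling_three_at_40.1, registryCoupling_three_at_40.2]

/-- **`D₆ = L₁₂ʰᶜᵖ − L₁₂ᶠᶜᶜ` at `c² = 2/3`**: `0.000413572 ≤ D₆ ≤ 0.000413573`. [folklore] -/
theorem hcp_sub_fcc_six_bounds :
    (0.000413572 : ℝ) ≤ hcpInvPowSum 6 (Real.sqrt (2 / 3)) - fccInvPowSum 6 (Real.sqrt (2 / 3)) ∧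
      hcpInvPowSum 6 (Real.sqrt (2 / 3)) - fccInvPowSum 6 (Real.sqrt (2 / 3)) ≤ 0.000413573 := by
  obtain ⟨h1, h2⟩ := abs_le.1 hcp_sub_fcc_six_trunc
  generalize Real.sqrt (2 / 3) = c at h1 h2 ⊢
  simp only [sum_range_succ, sum_range_zero] at h1 h2
  norm_num at h1 h2
  constructor <;> linarith [registryCoupling_six_at_2.1, registryCoupling_six_at_2.2, registryCoupling_six_at_3.1, registryCoupling_six_at_3.2, registryCoupling_six_at_4.1, registryCoupling_six_at_4.2, registryCoupling_six_at_8.1, registryCoupling_six_at_8.2, registryCoupling_six_at_9.1, registryCoupling_six_at_9.2, registryCoupling_six_at_10.1, registryCoupling_six_at_10.2]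

/-- **`L₆ʰᶜᵖ` at `c² = 2/3`**: `14.4542 ≤ L₆ʰᶜᵖ ≤ 14.4593` (printed value `14.45490`). [folklore] -/
theorem hcpInvPowSum_three_bounds :
    (14.4542 : ℝ) ≤ hcpInvPowSum 3 (Real.sqrt (2 / 3)) ∧ hcpInvPowSum 3 (Real.sqrt (2 / 3)) ≤ 14.4593 := by
  obtain ⟨h1, h2⟩ := hcpInvPowSum_three_trunc
  generalize Real.sqrt (2 / 3) = c at h1 h2 ⊢
  simp only [sum_range_succ, sum_range_zero] at h1 h2
  norm_num at h1 h2
  constructor <;> linarith [layerSum_three_at_0.1, layerSum_three_at_0.2, layerSum_three_at_1.1, layerSum_three_at_1.2, layerSum_three_at_2.1, layerSum_three_at_2.2, layerSum_three_at_3.1, layerSum_three_at_3.2, layerSum_three_at_4.1, layerSum_three_at_4.2, layerSum_three_at_5.1, layerSum_three_at_5.2, layerSum_three_at_6.1, layerSum_three_at_6.2, layerSum_three_at_7.1, layerSum_three_at_7.2, layerSum_three_at_8.1, layerSum_three_at_8.2, layerSum_three_at_9.1, layerSum_three_at_9.2, layerSum_three_at_10.1, layerSum_three_at_10.2, layerSum_three_at_11.1,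 layerSum_three_at_11.2, layerSum_three_at_12.1, layerSum_three_at_12.2, layerSum_three_at_13.1, layerSum_three_at_13.2, layerSum_three_at_14.1, layerSum_three_at_14.2, layerSum_three_at_15.1, layerSum_three_at_15.2, layerSum_three_at_16.1, layerSum_three_at_16.2]

/-- **`L₁₂ʰᶜᵖ` at `c² = 2/3`**: `12.1322937 ≤ L₁₂ʰᶜᵖ ≤ 12.1322946` (printed value `12.13229`). [folklore] -/
theorem hcpInvPowSum_six_bounds :
    (12.1322937 : ℝ) ≤ hcpInvPowSum 6 (Real.sqrt (2 / 3)) ∧ hcpInvPowSum 6 (Real.sqrt (2 / 3)) ≤ 12.1322946 := by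
  obtain ⟨h1, h2⟩ := hcpInvPowSum_six_trunc
  generalize Real.sqrt (2 / 3) = c at h1 h2 ⊢
  simp only [sum_range_succ, sum_range_zero] at h1 h2
  norm_num at h1 h2
  constructor <;> linarith [layerSum_six_at_0.1, layerSum_six_at_0.2, layerSum_six_at_1.1, layerSum_six_at_1.2, layerSum_six_at_2.1, layerSum_six_at_2.2, layerSum_six_at_3.1, layerSum_six_at_3.2, layerSum_six_at_4.1, layerSum_six_at_4.2, layerSum_six_at_5.1, layerSum_six_at_5.2, layerSum_six_at_6.1, layerSum_six_at_6.2]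


end Literature.MathematicalPhysics.StatisticalMechanics.StackingSums

namespace Literature.MathematicalPhysics.StatisticalMechanics.StackingSums

open Finset

/-- **`L₆ᶠᶜᶜ` at the cubic ratio**: `14.4532 ≤ L₆ᶠᶜᶜ ≤ 14.4584` (printed value `14.45392`). [folklore] -/
theorem fccInvPowSum_three_bounds :
    (14.4532 : ℝ) ≤ fccInvPowSum 3 (Real.sqrt (2 / 3)) ∧ fccInvPowSum 3 (Real.sqrt (2 / 3)) ≤ 14.4584 := by
  have h1 := hcpInvPowSum_three_bounds
  have h2 := hcp_sub_fcc_three_bounds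
  constructor <;> linarith [h1.1, h1.2, h2.1, h2.2]

/-- **`L₁₂ᶠᶜᶜ` at the cubic ratio**: `12.13188 ≤ L₁₂ᶠᶜᶜ ≤ 12.131882` (printed value `12.13188`).
[folklore] -/
theorem fccInvPowSum_six_bounds :
    (12.13188 : ℝ) ≤ fccInvPowSum 6 (Real.sqrt (2 / 3)) ∧ fccInvPowSum 6 (Real.sqrt (2 / 3)) ≤ 12.131882 := by
  have h1 := hcpInvPowSum_six_bounds
  have h2 := hcp_sub_fcc_six_bounds
  constructor <;> linarith [h1.1, h1.2, h2.1, h2.2]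

/-- **THE SHAPE GAP (certified)**: with `x = L₆`, `y = L₁₂` of hcp resp. fcc at the ideal/cubic
ratio `c² = 2/3`,
`0.0017363 ≤ x_h²/y_h − x_f²/y_f ≤ 0.0017423`.
Since `min_{a>0} ½(a⁻¹² y/12 − a⁻⁶ x/6) = −x²/(24 y)`, this is `24 ×` the gap between the optimal
Lennard-Jones lattice energies per particle of fcc and of ideal hcp (`LennardJonesHcpBelowFcc`).
Proof: `x_h²y_f − x_f²y_h = 2 x_h y_h D₃ − x_h² D₆ − y_h D₃²` with the certified enclosures of
`x_h, y_h, D₃ = x_h − x_f, D₆ = y_h − y_f`, monomial by monomial. [folklore] -/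
theorem hcp_fcc_shapeGap :
    (0.0017363 : ℝ) ≤ hcpInvPowSum 3 (Real.sqrt (2 / 3)) ^ 2 / hcpInvPowSum 6 (Real.sqrt (2 / 3)) -
        fccInvPowSum 3 (Real.sqrt (2 / 3)) ^ 2 / fccInvPowSum 6 (Real.sqrt (2 / 3)) ∧
      hcpInvPowSum 3 (Real.sqrt (2 / 3)) ^ 2 / hcpInvPowSum 6 (Real.sqrt (2 / 3)) -
        fccInvPowSum 3 (Real.sqrt (2 / 3)) ^ 2 / fccInvPowSum 6 (Real.sqrt (2 / 3)) ≤ 0.0017423 := by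
  obtain ⟨hx0, hx1⟩ := hcpInvPowSum_three_bounds
  obtain ⟨hy0, hy1⟩ := hcpInvPowSum_six_bounds
  obtain ⟨ha3, hb3⟩ := hcp_sub_fcc_three_bounds
  obtain ⟨ha6, hb6⟩ := hcp_sub_fcc_six_bounds
  set x := hcpInvPowSum 3 (Real.sqrt (2 / 3)) with hx
  set y := hcpInvPowSum 6 (Real.sqrt (2 / 3)) with hy
  set u := fccInvPowSum 3 (Real.sqrt (2 / 3)) with hu
  set v := fccInvPowSum 6 (Real.sqrt (2 / 3)) with hv
  set d₃ := x - u with hd₃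
  set d₆ := y - v with hd₆
  have hypos : 0 < y := by linarith
  have hvpos : 0 < v := by linarith
  have hkey : x ^ 2 / y - u ^ 2 / v = (2 * x * y * d₃ - x ^ 2 * d₆ - y * d₃ ^ 2) / (y * v) := by
    have eu : u = x - d₃ := by rw [hd₃]; ring
    have ev : v = y - d₆ := by rw [hd₆]; ring
    rw [div_sub_div _ _ hypos.ne' hvpos.ne']
    congr 1
    rw [eu, ev]; ring
  rw [hkey]
  have hyv : 0 < y * v := mul_pos hypos hvpos
  -- monomial bounds
  have hx_nn : (0 : ℝ) ≤ x := by linarith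
  have m1lo : 2 * 14.4542 * 12.1322937 * 0.00097526 ≤ 2 * x * y * d₃ := by
    have h1 : (14.4542 : ℝ) * 12.1322937 ≤ x * y := mul_le_mul hx0 hy0 (by norm_num) hx_nn
    have h2 : (14.4542 : ℝ) * 12.1322937 * 0.00097526 ≤ x * y * d₃ :=
      mul_le_mul h1 ha3 (by norm_num) (by positivity)
    linarith
  have m1hi : 2 * x * y * d₃ ≤ 2 * 14.4593 * 12.1322946 * 0.00097722 := by
    have h1 : x * y ≤ (14.4593 : ℝ) * 12.1322946 := mul_le_mul hx1 hy1 hypos.le (by norm_num)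
    have h2 : x * y * d₃ ≤ (14.4593 : ℝ) * 12.1322946 * 0.00097722 :=
      mul_le_mul h1 hb3 (by linarith) (by norm_num)
    linarith
  have m2lo : (14.4542 : ℝ) ^ 2 * 0.000413572 ≤ x ^ 2 * d₆ :=
    mul_le_mul (pow_le_pow_left₀ (by norm_num) hx0 2) ha6 (by norm_num) (by positivity)
  have m2hi : x ^ 2 * d₆ ≤ (14.4593 : ℝ) ^ 2 * 0.000413573 :=
    mul_le_mul (pow_le_pow_left₀ hx_nn hx1 2) hb6 (by linarith) (by positivity)
  have m3lo : (12.1322937 : ℝ) * 0.00097526 ^ 2 ≤ y * d₃ ^ 2 :=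
    mul_le_mul hy0 (pow_le_pow_left₀ (by norm_num) ha3 2) (by positivity) hypos.le
  have m3hi : y * d₃ ^ 2 ≤ (12.1322946 : ℝ) * 0.00097722 ^ 2 :=
    mul_le_mul hy1 (pow_le_pow_left₀ (by linarith) hb3 2) (by positivity) (by norm_num)
  -- the denominator
  have hyv_hi : y * v ≤ (12.1322946 : ℝ) * (12.1322946 - 0.000413572) :=
    mul_le_mul hy1 (by linarith) hvpos.le (by norm_num)
  have hyv_lo : (12.1322937 : ℝ) * (12.1322937 - 0.000413573) ≤ y * v :=
    mul_le_mul hy0 (by linarith) (by norm_num) hypos.le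
  constructor
  · rw [le_div_iff₀ hyv]
    nlinarith
  · rw [div_le_iff₀ hyv]
    nlinarith

/-! ## The energies per particle as functions of the scale -/

/-- **Scaling of the Lennard-Jones lattice energy**: for `y > 0` and all `x`, `a`,
`−x²/(24y) ≤ ½ (a⁻¹² y/12 − a⁻⁶ x/6)` (complete the square in `a⁻⁶`). [folklore] -/
theorem lj_scale_energy_ge (x : ℝ) {y : ℝ} (hy : 0 < y) (a : ℝ) :
    -(x ^ 2 / (24 * y)) ≤ 1 / 2 * (1 / 12 * (a⁻¹) ^ 12 * y - 1 / 6 * (a⁻¹) ^ 6 * x) := by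
  set t := (a⁻¹) ^ 6 with ht
  have e : (a⁻¹) ^ 12 = t ^ 2 := by rw [ht]; ring
  rw [e]
  have key : 1 / 2 * (1 / 12 * t ^ 2 * y - 1 / 6 * t * x) + x ^ 2 / (24 * y) = (y * t - x) ^ 2 / (24 * y) := by
    field_simp; ring
  have : 0 ≤ (y * t - x) ^ 2 / (24 * y) := by positivity
  linarith

/-- **The minimum is attained** at `a = (y/x)^{1/6}`: `½ (a⁻¹² y/12 − a⁻⁶ x/6) = −x²/(24y)`.
[folklore] -/
theorem lj_scale_energy_attained {x y : ℝ} (hx : 0 < x) (hy : 0 < y) :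
    ∃ a : ℝ, 0 < a ∧ 1 / 2 * (1 / 12 * (a⁻¹) ^ 12 * y - 1 / 6 * (a⁻¹) ^ 6 * x) = -(x ^ 2 / (24 * y)) := by
  refine ⟨(y / x) ^ ((1 : ℝ) / 6), Real.rpow_pos_of_pos (div_pos hy hx) _, ?_⟩
  have h6 : ((y / x) ^ ((1 : ℝ) / 6)) ^ 6 = y / x := by
    rw [← Real.rpow_natCast, ← Real.rpow_mul (div_pos hy hx).le]; norm_num
  set a := (y / x) ^ ((1 : ℝ) / 6) with ha
  have ha0 : 0 < a := Real.rpow_pos_of_pos (div_pos hy hx) _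
  have ht : (a⁻¹) ^ 6 = x / y := by rw [inv_pow, h6, inv_div]
  have e : (a⁻¹) ^ 12 = ((a⁻¹) ^ 6) ^ 2 := by ring
  rw [e, ht]
  field_simp
  ring

end Literature.MathematicalPhysics.StatisticalMechanics.StackingSums

end
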